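import Summits.BirchSwinnertonDyer.BirchSwinnertonDyer.Theorems.UniversalToricDescentToricKernelAtThreeFlat
import HarnessLib

/-!
# K9 residual `WildRankOne` (stmt-BirchSwinnertonDyer-19200), ρ̄₃-ONTO rows: the Schneider-free ANTICYCLOTOMIC road at the
# wild prime `3` WITHOUT a twin — `BSD₃(E)` on the onto wild rank-one rows from ONE research input, the ♭-main-conjecture
# EQUALITY `Ch_Λ(X_ac(E/K_∞) strict at 𝔭′)·𝓞_{ℂ₃}⟦T⟧ = (Q)` at the additive point, plus exact control
# (`WildSplitControlAtThree`, closed modulo published facts by kmc g16/g17), the rank-zero wild partner leaf, and the two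
# refereed inputs (Hsieh any level; LZZ additive) that now carry the VALUE

Prover seat `bsd-potss-kmc` (g19), 2026-08-27. HONEST FRAMING: ONE THEOREM (0 definitions, 0 named facts, 0 `sorry`);
CONDITIONAL on every displayed hypothesis; closes nothing; BSD₃ for no curve. WHY (memo v18 §5, the seat's own line): the
(δ) line «KMC₃ + Perrin-Riou at an additive 3» for 19200 needs a p-adic height that does not exist at a potentially
supersingular additive prime; the anticyclotomic reading needs none, and after this session its VALUE input is print
(`UniversalToricDescentWaldspurgerFlat.wildSplitWaldspurgerAtThree_flat`, Hsieh + LZZ) and its CONTROL input is print modulo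
eight published facts (crux #5 20386, `wildSplitControlAtThreeOfPublishedFacts_proof`). Route `UniversalToricDescent` reaches the
same rows through a semistable TWIN (transport crux #2); this file records the twin-free form of the kernel, whose ONE
research hypothesis `hEq♭` is the (∅,0) main conjecture for `f_E` ITSELF at the wild split `3` over the wide receptacle —
the statement a universal/Eisenstein/Kolyvagin argument at the additive point would have to deliver (UTD 20395 is its
«⊆» half in `R₀` currency; SOED's crux J its Kolyvagin half).

**`bsdp_three_of_flatIMCEq_of_control_of_rankZero`**: `hA → hL → ToricPublishedInputs → hEq♭ → WildSplitControlAtThree →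
WildRankZeroTwistAtThree → ∀ W` (`ClassO6 W 3`, `r_an = 1`, `ρ̄₃` onto) `→ BSDp W 3` — `toricKernelAtThree_flat` with the
transport `hT♭`, the twin's IMC `hI♭` and the twin deleted, `hEq♭` in their place. Proof = the same JSW §7.4 assembly.

References: [JetchevSkinnerWan2017] §7.4.1; [Castella2018] Thm 2.3, §5; [Hsieh2014] Thm A; [LiuZhangZhang2018] Thm 1.5.1/1.5.3;
[GrossZagier1986] I.(6.3); [FriedbergHoffstein1995] Thm B.
-/

noncomputable section

open scoped Classical

set_option linter.dupNamespace false
set_option autoImplicit false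

namespace Summit.BirchSwinnertonDyer.BirchSwinnertonDyer.Theorems.UniversalToricDescentWaldspurgerFlat

open WeierstrassCurve NumberField IsDedekindDomain Field PowerSeries
  Literature.NumberTheory.EllipticCurves
  Literature.NumberTheory.EllipticCurves.ModularForms
  Literature.NumberTheory.EllipticCurves.Rank1Residual
  Literature.NumberTheory.EllipticCurves.KrizLi2019
  Literature.NumberTheory.GaloisRepresentations
  Summit.BirchSwinnertonDyer.Rank1Residual
  Summit.BirchSwinnertonDyer.Rank1Residual.Additive
  Summit.BirchSwinnertonDyer.Rank1Residual.X11b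
  Summit.BirchSwinnertonDyer.Rank1Residual.X11b.AcSelmer
  Summit.BirchSwinnertonDyer.Rank1Residual.X11b.Halves
  Summit.BirchSwinnertonDyer.Rank1Residual.X11b.CongruenceLimit
  Summit.BirchSwinnertonDyer.BirchSwinnertonDyer.Theses.UniversalToricDescent

/-- **`BSD₃` on the onto wild rank-one rows from the ♭-IMC EQUALITY AT `E`, exact control, the rank-zero partner and two
refereed inputs — no twin, no height, no `R₀`.** Hypotheses: `hA` (Hsieh 2014 Thm A any level), `hL` (LZZ 2018 Thm 1.5.1/1.5.3
additive), `ToricPublishedInputs` (UTD's published inputs by name), `hEq♭` = for `W` on the cell, every classical-Heegner `K`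
for `N(E)` (so `3` split), every anticyclotomic `(κ, γ)`, degree-one `𝔭 ∋ 3`, `𝔭′ ∋ 3` with `𝔭′ ≠ 𝔭`, `ι′` inducing `𝔭`, and
every ♭-frame `Q` of `Dt.f` at `(ι′, 𝔭)`: `(XAc.charIdeal (W.baseChange K) 3 κ 𝔭′ ∅ γ).map (PowerSeries.map (R1.toCpInt 3)) =
Ideal.span {Q}` (RESEARCH-GRADE: the (∅,0) main conjecture for `f_E` at the wild split `3`), `WildSplitControlAtThree` (UTD
crux #5, closed modulo published facts) and `WildRankZeroTwistAtThree` (the rank-zero wild leaf, residual). Conclusion: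
`BSDp W 3` for every `W` with `ClassO6 W 3`, `r_an = 1`, `ρ̄₃` onto. CONDITIONAL; nothing booked.
[cite: JetchevSkinnerWan2017, §7.4.1 (arXiv:1512.06894 p. 30)] [cite: Hsieh2014, Thm. A p. 712 (Doc. Math. 19)]
[cite: LiuZhangZhang2018, Thm 1.5.1 and Thm 1.5.3 (Duke Math. J. 167 pp. 748–749)] -/
theorem bsdp_three_of_flatIMCEq_of_control_of_rankZero
    (hA : Hsieh2014.thmA_exists_isHsiehLFunction_unrPeriod_anyLevel)
    (hL : LiuZhangZhang2018.thm151_thm153_modularCurve_heegnerVector_additive)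
    (hF : ToricPublishedInputs)
    (hEq : ∀ (W : WeierstrassCurve ℚ) [W.IsElliptic] [W.IsGloballyMinimal] (N : ℕ) [NeZero N] (K : Type) [Field K]
      [NumberField K] (Dt : ModularParametrizationData W N),
      ClassO6 W 3 → W.HasSurjectiveModNGaloisRep 3 → W.analyticRank = 1 → W.conductorNorm ℤ = N →
      IsImaginaryQuadratic K → SatisfiesHeegnerHypothesis N K →
      ∀ (κ : ZpExtension K 3), κ.IsAnticyclotomic → ∀ (γ : Field.absoluteGaloisGroup K) [Fact (κ.IsTopGenerator γ)]
        (𝔭 : HeightOneSpectrum (𝓞 K)), ((3 : ℕ) : 𝓞 K) ∈ 𝔭.asIdeal → 𝔭.asIdeal.ramificationIdx (𝓞 ℚ) = 1 →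
        𝔭.asIdeal.inertiaDeg (𝓞 ℚ) = 1 → ∀ (𝔭' : HeightOneSpectrum (𝓞 K)), ((3 : ℕ) : 𝓞 K) ∈ 𝔭'.asIdeal → 𝔭' ≠ 𝔭 →
        ∀ (ι' : PadicAlgCl 3 ≃+* ℂ), SchneiderFree.BranchInducesPrime 3 ι' 𝔭 →
        ∀ (ΩK : ℂ) (Ωp : ℂ_[3]) (Q : PowerSeries (PadicComplexInt 3)), ΩK ≠ 0 → Ωp ≠ 0 →
          R1.IsBDPLFunctionInt 3 ι' 𝔭 κ γ Dt.f ΩK Ωp Q →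
          (XAc.charIdeal (W.baseChange K) 3 κ 𝔭' ∅ γ).map (PowerSeries.map (R1.toCpInt 3)) = Ideal.span {Q})
    (hC : WildSplitControlAtThree) (hZ : WildRankZeroTwistAtThree) :
    ∀ (W : WeierstrassCurve ℚ) [W.IsElliptic] [W.IsGloballyMinimal], ClassO6 W 3 → W.analyticRank = 1 →
      W.HasSurjectiveModNGaloisRep 3 → BSDp W 3 := by
  intro W _ _ hO6 hr hsurj
  obtain ⟨hGZ, hKo, hGZK, hmod, hmodP, -, hGZ73, hFH, hpar, hHP⟩ := hF
  haveI hN0 : NeZero (W.conductorNorm ℤ) := ⟨W.conductorNorm_pos_holds.ne'⟩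
  -- (a) DATA. parity: `r_an = 1` is odd, so `w(E) = -1`
  have hw : W.rootNumber = -1 := by
    rcases W.rootNumber_eq_one_or with h | h
    · exfalso
      have heven : Even W.analyticRank := (hpar W).mpr h
      rw [hr] at heven
      exact Nat.not_even_one heven
    · exact h
  -- Friedberg–Hoffstein with auxiliary modulus `2`: Heegner for `N(E)` and `2` split (odd `d_K`)
  obtain ⟨K, _, _, hK, -, hHN, hH2, hLt⟩ := hFH W hw 2 two_ne_zero 0
  have hodd : Odd (NumberField.discr K) := by
    have h8 := Literature.SatisfiesHeegnerHypothesis.discr_emod_eight hK.1 hH2 (dvd_refl 2)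
    rw [Int.odd_iff]; omega
  -- `3 ∣ N(E)` (additive) splits in `K`
  have h3N : 3 ∣ W.conductorNorm ℤ :=
    (W.dvd_conductorNorm_iff_not_hasGoodReductionAtPrime 3).mpr (not_good_of_addv W 3 hO6.2.1)
  have hsplit : SplitsIn K 3 := hHN 3 Nat.prime_three h3N
  -- the Heegner point over `K` and its data; non-torsion by Gross–Zagier
  obtain ⟨P, Dt, H, ι, hP⟩ := hHP W K hK hHN
  have hL0 : W.entireLFunction 1 = 0 := entireLFunction_one_eq_zero_of_analyticRank_eq_one hr
  obtain ⟨-, hderiv⟩ := leadingLCoeff_eq_deriv_of_analyticRank_eq_one hr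
  have hLK : LDerivEK W K ≠ 0 := by
    rw [lDerivEK_eq_deriv_mul W K hmod hL0]; exact mul_ne_zero hderiv hLt
  have hnt : ¬ IsOfFinAddOrder P :=
    (lDerivEK_ne_zero_iff_not_isOfFinAddOrder W (W.conductorNorm ℤ) K (hGZ _ W K) hK hHN
      ⟨Dt, H, ι, hP⟩).mp hLK
  -- Kolyvagin: `rank E(K) = 1`, `Ш(E/K)` finite
  obtain ⟨hrk, hfin⟩ := hKo (W.conductorNorm ℤ) W K hK hHN ⟨Dt, H, ι, hP⟩ hnt
  -- a frame `(κ, γ, 𝔭)` and the other prime `𝔭′ ≠ 𝔭` above `3`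
  obtain ⟨κ, γ, -, hκ, hγ, -⟩ := X11b.exists_anticyclotomic_generator_prime (p := 3) hK
  haveI : Fact (κ.IsTopGenerator γ) := ⟨hγ⟩
  obtain ⟨𝔭, h𝔭, he, hf⟩ := X11b.exists_degreeOnePrime_of_splitsIn K 3 hK.1 hsplit
  obtain ⟨𝔭', hne, h𝔭', he', hf'⟩ := X11b.Three.exists_ne_degreeOne_prime hK.1 h𝔭 he hf
  -- (b) PLUMBING. ♭-frame and unit-norm value at `(κ, γ, 𝔭)` — crux #4 DISCHARGED (Hsieh + LZZ)
  obtain ⟨ι', hind, ΩK, Ωp, Q, hΩK, hΩp, hBDP, u, hu, hval⟩ :=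
    wildSplitWaldspurgerAtThree_flat hA hL W (W.conductorNorm ℤ) K Dt H ι P hO6 hsurj hr rfl hK hHN hLt hP hnt κ hκ
      γ 𝔭 h𝔭 he hf
  -- the ♭-IMC EQUALITY for `E` at the frame `Q` (the research input)
  have heq : (XAc.charIdeal (W.baseChange K) 3 κ 𝔭' ∅ γ).map (PowerSeries.map (R1.toCpInt 3)) =
      Ideal.span {Q} :=
    hEq W (W.conductorNorm ℤ) K Dt hO6 hsurj hr rfl hK hHN κ hκ γ 𝔭 h𝔭 he hf 𝔭' h𝔭' hne ι' hind ΩK Ωp Q hΩK hΩp hBDP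
  -- control EQUALITY at `𝔭′` (CTL₀ included)
  have hctl : SchneiderFree.AdditiveControlOnTreeAt 3 κ 𝔭' γ (embAt K 3 𝔭' h𝔭' he' hf') P :=
    hC W (W.conductorNorm ℤ) K Dt H ι P hO6 hsurj hr rfl hK hHN hLt hP hnt (hKo _ W K) κ hκ γ 𝔭'
      h𝔭' he' hf'
  obtain ⟨n, hn, hneq⟩ := hctl
  -- the value read through the logarithm at `𝔭′` (rank one: `(log_{𝔭′} P)² = (log_𝔭 P)²`)
  have hc0 : Dt.c ≠ 0 := Dt.maninConstant_ne_zero_holds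
  have hc0' : (Dt.c : ℚ_[3]) ≠ 0 := by exact_mod_cast hc0
  have hlog : logOmega W 3 (embAt K 3 𝔭' h𝔭' he' hf') P ≠ 0 := X11b.R1.logOmega_ne_zero W 3 _ hnt
  have hsq : (algebraMap ℚ_[3] ℂ_[3] (logOmega W 3 (embAt K 3 𝔭 h𝔭 he hf) P / (Dt.c : ℚ_[3]))) ^ 2 =
      (algebraMap ℚ_[3] ℂ_[3] (logOmega W 3 (embAt K 3 𝔭' h𝔭' he' hf') P / (Dt.c : ℚ_[3]))) ^ 2 := by
    rw [← map_pow, ← map_pow, div_pow, div_pow,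
      SchneiderFreeAdditiveX3.sq_logOmega_embAt_eq_of_rank_one W 3 hK.1 hrk h𝔭 he hf h𝔭' he' hf' P]
  have hval' : IntSeries.HasValueAt Q 0
      (u * (algebraMap ℚ_[3] ℂ_[3] (logOmega W 3 (embAt K 3 𝔭' h𝔭' he' hf') P / (Dt.c : ℚ_[3]))) ^ 2) := by
    rw [← hsq]; exact hval
  have hy0 : logOmega W 3 (embAt K 3 𝔭' h𝔭' he' hf') P / (Dt.c : ℚ_[3]) ≠ 0 := div_ne_zero hlog hc0'
  -- both sockets at slack `v₃(c)` at the frame `(κ, 𝔭′, γ, embAt 𝔭′)`, by §1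
  have hlow : SchneiderFree.AdditiveIMCLowerBDPOnTreeLeAt 3 κ 𝔭' γ (embAt K 3 𝔭' h𝔭' he' hf')
      (padicValNat 3 Dt.c.natAbs) P := by
    obtain ⟨htors, f, hfI, hf0, hfn⟩ := hn
    have hmem : PowerSeries.map (R1.toCpInt 3) f ∈ Ideal.span {Q} := by
      have h3 := heq.le
      rw [hfI, map_span_singleton_powerSeries] at h3
      exact (Ideal.span_singleton_le_iff_mem _).mp h3
    obtain ⟨-, hle⟩ := int_two_mul_valuation_le_of_map_mem_span hf0 hmem hu hval'
    rw [div_eq_mul_inv, Padic.valuation_mul hlog (inv_ne_zero hc0'), Padic.valuation_inv,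
      Padic.valuation_intCast, valuation_logOmega hlog, hfn] at hle
    refine ⟨n, ⟨htors, f, hfI, hf0, hfn⟩, ?_⟩
    simp only [padicValInt] at hle
    linarith
  have hup : SchneiderFree.Upper.AdditiveIMCUpperBDPOnTreeLeAt 3 κ 𝔭' γ (embAt K 3 𝔭' h𝔭' he' hf')
      (padicValNat 3 Dt.c.natAbs) P := by
    obtain ⟨htors, f, hfI, hf0, hfn⟩ := hn
    have hmem : Q ∈ Ideal.span {PowerSeries.map (R1.toCpInt 3) f} := by
      have h3 := heq.ge
      rw [hfI, map_span_singleton_powerSeries] at h3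
      exact (Ideal.span_singleton_le_iff_mem _).mp h3
    have hle := int_valuation_le_two_mul_of_mem_span_map hf0 hmem hu hy0 hval'
    rw [div_eq_mul_inv, Padic.valuation_mul hlog (inv_ne_zero hc0'), Padic.valuation_inv,
      Padic.valuation_intCast, valuation_logOmega hlog, hfn] at hle
    refine ⟨n, ⟨htors, f, hfI, hf0, hfn⟩, ?_⟩
    simp only [padicValInt] at hle
    linarith
  -- the EXACT index at slack `v₃(c)` (both halves), by K1's links with the control equality
  have hlo : SchneiderFree.IndexLowerBoundLeAt W 3 K P (padicValNat 3 Dt.c.natAbs) :=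
    SchneiderFreeAdditiveX3.indexLowerBoundLeAt_of_imcLowerLe_of_control rfl hK hHN hfin hlow
      ⟨n, hn, hneq⟩
  have hupI : SchneiderFree.Upper.IndexUpperBoundLeAt W 3 K P (padicValNat 3 Dt.c.natAbs) :=
    SchneiderFree.Upper.indexUpperBoundLeAt_of_imcUpperLe_of_control rfl hK hHN hfin hup ⟨n, hn, hneq⟩
  -- (c) TERMINAL STEP: a globally minimal model of the twist, then p528981
  have hD0 : (NumberField.discr K : ℚ) ≠ 0 := by exact_mod_cast NumberField.discr_ne_zero K
  haveI : (W.quadraticTwist (NumberField.discr K : ℚ)).IsElliptic := W.isElliptic_quadraticTwist hD0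
  obtain ⟨Cd, hCd⟩ := hasGlobalMinimalModel_rat_holds (W.quadraticTwist (NumberField.discr K : ℚ))
  haveI : (Cd • W.quadraticTwist (NumberField.discr K : ℚ)).IsGloballyMinimal := hCd
  exact SchneiderFree.Exact.bsdp_three_of_exactIndexManin_of_wAllExclAddWildRankZero hGZ hKo hGZK hmod
    hGZ73 hZ W hO6 hsurj hr (W.conductorNorm ℤ) K Dt H ι P
    (Cd • W.quadraticTwist (NumberField.discr K : ℚ)) rfl hK hodd hHN hLt hP ⟨Cd, rfl⟩ hlo hupI

end Summit.BirchSwinnertonDyer.BirchSwinnertonDyer.Theorems.UniversalToricDescentWaldspurgerFlat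

end
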